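import Summits.PneNP.PneNP.Theorems.KarlinRubinMonotoneSufficesBlockPinning

/-!
# Crux `MonotoneSuffices` (stmt-PneNP-18026), line `Sketch` — BLOCK PINNING, part 3: the first two
# rungs of the negation ladder, for free

The block-pinning rung (`blockPinning`, part 2) in the exact formats of the line's first two rungs,
with the counting hypothesis `2^{|block|} ≤ (s n + n)^c` REPLACED by clique-sparsity of the block
(`#block · k² / n² → 0`, e.g. any block of `o(n^{1+2δ})` slots at clique size `k ≤ n^{1/2-δ}`) and the
size bound `(s n + n)^{c+1}` replaced by `s n + 2`:

* `pin_negatedInputs` — cf. `stub_negatedInputs` (rung 1, negated INPUT variables `T n`):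
  a De Morgan detector negating only the variables of a clique-sparse set `T n` is simulated by
  `{∧₂,∨₂,0,1}`-circuits of size `≤ s n + 2` with error sum `→ 0`;
* `pin_juntaNegations` — cf. `stub_juntaNegations` (rung 1.5, negations of juntas on `S n`): the same
  for wires `¬ g_{n,j}(x)` with every `g_{n,j}` depending only on a clique-sparse set `S n`
  (`update`-invariance off `S n`, eventually in `n`, as in the original rung).
-/

set_option linter.dupNamespace false -- `Summit.PneNP.PneNP.…`: summit = sub-problem name (D-0017 single-conjunct layout)

namespace Summit.PneNP.PneNP.Theorems.MonotoneSuffices.BlockPinning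

open Finset Filter Function Literature.Computability.Complexity Literature.Probability.RandomGraphs.PlantedClique
open scoped ENNReal

/-- From `update`-invariance off `S` to dependence on `S` only: if `g (update x i b) = g x` for all
`i ∉ S`, then `g x = g x'` whenever `x, x'` agree on `S`. [folklore] -/
theorem eq_of_agree_of_update_invariant {ι : Type*} [DecidableEq ι] [Fintype ι] (S : Finset ι)
    (g : (ι → Bool) → Bool) (hg : ∀ (x : ι → Bool) (i : ι), i ∉ S → ∀ b : Bool, g (update x i b) = g x)
    (x x' : ι → Bool) (hagree : ∀ i ∈ S, x i = x' i) : g x = g x' := by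
  -- induct on a set of coordinates off `S` outside which `x` and `x'` agree
  suffices h : ∀ (D : Finset ι) (y : ι → Bool), (∀ i, y i ≠ x' i → i ∈ D) → (∀ i ∈ D, i ∉ S) → g y = g x' from
    h (univ.filter fun i => x i ≠ x' i) x (fun i hi => mem_filter.2 ⟨mem_univ _, hi⟩)
      (fun i hi hiS => (mem_filter.1 hi).2 (hagree i hiS))
  intro D
  induction D using Finset.induction_on with
  | empty =>
    intro y hy _
    have : y = x' := funext fun i => by
      by_contra h
      exact absurd (hy i h) (by simp)
    rw [this]
  | insert i D hiD ih =>
    intro y hy hDS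
    have hiS : i ∉ S := hDS i (mem_insert_self i D)
    have step : g y = g (update y i (x' i)) := (hg y i hiS (x' i)).symm
    rw [step]
    refine ih _ (fun j hj => ?_) (fun j hj => hDS j (mem_insert_of_mem hj))
    by_cases hji : j = i
    · subst hji
      rw [update_self] at hj
      exact absurd rfl hj
    · rw [update_of_ne hji] at hj
      have := hy j hj
      rcases mem_insert.1 this with h | h
      · exact absurd h hji
      · exact h

/-- **Rung 1 for free (block pinning).** Negated INPUT variables on a clique-sparse set `T n`
(`#(T n) · k² / n² → 0`) cost nothing: cf. `stub_negatedInputs`, whose hypothesis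
`2^{|T n|} ≤ (s n + n)^c` and size `(s n + n)^{c+1}` become "clique-sparse" and `s n + 2`. [folklore] -/
theorem pin_negatedInputs :
    ∀ (k s : ℕ → ℕ) (T : (n : ℕ) → Finset ((⊤ : SimpleGraph (Fin n)).edgeSet)) (D : (n : ℕ) → Circuit ((⊤ : SimpleGraph (Fin n)).edgeSet ⊕ (⊤ : SimpleGraph (Fin n)).edgeSet)), (∀ᶠ n : ℕ in atTop, (D n).IsOver monotoneBasis01 ∧ (D n).size ≤ s n) → Tendsto (fun n : ℕ => (erdosRenyiHalf n).toOuterMeasure {x | (D n).eval (Sum.elim x (fun i => if i ∈ T n then !(x i) else true)) = true} + (plantedCliqueDist n (k n)).toOuterMeasure {x | (D n).eval (Sum.elim x (fun i => if i ∈ T n then !(x i) else true)) = false}) atTop (nhds 0) → Tendsto (fun n : ℕ => (#(T n) : ℝ) * (k n : ℝ) ^ 2 / (n : ℝ) ^ 2) atTop (nhds 0) → ∃ M : (n : ℕ) → Circuit ((⊤ : SimpleGraph (Fin n)).edgeSet), (∀ᶠ n : ℕ in atTop, (M n).IsOver monotoneBasis01 ∧ (M n).size ≤ s n + 2) ∧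 Tendsto (fun n : ℕ => (erdosRenyiHalf n).toOuterMeasure {x | (M n).eval x = true} + (plantedCliqueDist n (k n)).toOuterMeasure {x | (M n).eval x = false}) atTop (nhds 0) := by
  intro k s T D hD herr hT
  refine blockPinning k s (fun n => (⊤ : SimpleGraph (Fin n)).edgeSet) T D
    (fun n x i => if i ∈ T n then !(x i) else true) (fun n x x' h => ?_) hD herr hT
  funext i
  by_cases hi : i ∈ T n
  · simp [hi, h i hi]
  · simp [hi]

/-- **Rung 1.5 for free (block pinning).** Negations (indeed arbitrary wires) of functions depending
only on a clique-sparse set `S n` of slots (`#(S n) · k² / n² → 0`; `update`-invariance off `S n`,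
eventually in `n`) cost nothing: cf. `stub_juntaNegations`, whose hypothesis `2^{|S n|} ≤ (s n + n)^c`
and size `(s n + n)^{c+1}` become "clique-sparse" and `s n + 2`. [folklore] -/
theorem pin_juntaNegations :
    ∀ (k s : ℕ → ℕ) (κ : ℕ → Type) (S : (n : ℕ) → Finset ((⊤ : SimpleGraph (Fin n)).edgeSet)) (D : (n : ℕ) → Circuit ((⊤ : SimpleGraph (Fin n)).edgeSet ⊕ κ n)) (g : (n : ℕ) → κ n → EdgeVec n → Bool), (∀ᶠ n : ℕ in atTop, (D n).IsOver monotoneBasis01 ∧ (D n).size ≤ s n ∧ ∀ (j : κ n) (x : EdgeVec n) (i : (⊤ : SimpleGraph (Fin n)).edgeSet), i ∉ S n → ∀ b : Bool, g n j (update x i b) = g n j x) → Tendsto (fun n : ℕ => (erdosRenyiHalf n).toOuterMeasure {x | (D n).eval (Sum.elim x (fun j => !(g n j x))) = true} + (plantedCliqueDist n (k n)).toOuterMeasure {x | (D n).eval (Sum.elim x (fun j => !(g n j x))) = false}) atTop (nhds 0) → Tendsto (fun n : ℕ => (#(S n) : ℝ) * (k n : ℝ) ^ 2 / (n : ℝ)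 ^ 2) atTop (nhds 0) → ∃ M : (n : ℕ) → Circuit ((⊤ : SimpleGraph (Fin n)).edgeSet), (∀ᶠ n : ℕ in atTop, (M n).IsOver monotoneBasis01 ∧ (M n).size ≤ s n + 2) ∧ Tendsto (fun n : ℕ => (erdosRenyiHalf n).toOuterMeasure {x | (M n).eval x = true} + (plantedCliqueDist n (k n)).toOuterMeasure {x | (M n).eval x = false}) atTop (nhds 0) := by
  intro k s κ S D g hD herr hS
  classical
  -- the junta property as a predicate on `n`; off it, replace the wires by constants in `x`
  let P : ℕ → Prop := fun n => ∀ (j : κ n) (x : EdgeVec n) (i : (⊤ : SimpleGraph (Fin n)).edgeSet),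
    i ∉ S n → ∀ b : Bool, g n j (update x i b) = g n j x
  let a : (n : ℕ) → EdgeVec n → κ n → Bool := fun n x j =>
    if P n then !(g n j x) else !(g n j (fun _ => false))
  have ha : ∀ (n : ℕ) (x x' : EdgeVec n), (∀ e ∈ S n, x e = x' e) → a n x = a n x' := by
    intro n x x' hxx'
    funext j
    by_cases hP : P n
    · simp only [a, if_pos hP]
      rw [eq_of_agree_of_update_invariant (S n) (g n j) (fun x i hi b => hP j x i hi b) x x' hxx']
    · simp only [a, if_neg hP]
  -- eventually the wires ARE `¬ g`
  have hPev : ∀ᶠ n : ℕ in atTop, P n := hD.mono fun n hn => hn.2.2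
  have haev : ∀ᶠ n : ℕ in atTop, ∀ x : EdgeVec n, a n x = fun j => !(g n j x) := by
    filter_upwards [hPev] with n hn
    intro x
    funext j
    simp only [a, if_pos hn]
  have herr' : Tendsto (fun n : ℕ => (erdosRenyiHalf n).toOuterMeasure {x | (D n).eval (Sum.elim x (a n x)) = true} +
      (plantedCliqueDist n (k n)).toOuterMeasure {x | (D n).eval (Sum.elim x (a n x)) = false}) atTop (nhds 0) := by
    refine herr.congr' ?_
    filter_upwards [haev] with n hn
    simp only [hn]
  exact blockPinning k s κ S D a ha (hD.mono fun n hn => ⟨hn.1, hn.2.1⟩) herr' hS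

end Summit.PneNP.PneNP.Theorems.MonotoneSuffices.BlockPinning
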